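import Mathlib
import HarnessLib
import Literature.Analysis.FluidPDE.VectorCalculus
import Literature.Analysis.FluidPDE.SphereIntegral
import Summits.NavierStokesRegularity.NavierStokesRegularity.Theorems.UnthreadedDoorAntidynamoWallOfSphereMeanEngine
import Summits.NavierStokesRegularity.NavierStokesRegularity.Theorems.UnthreadedDoorCapSymHeadPotential

/-!
# Route `UnthreadedDoor` / `ThreadingFlux`, crux `PoloidalLiouville` (stmt-NavierStokesRegularity-1222), antidynamo v2 skeleton
# (sha16 `4ebf5683127b`), WALL `stub_scalarLiouville`: WALL ⟺ ENGINE (spherical-mean gauge) — the converse and the exact equivalence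

Support file (seat leafhand-ns-unthreadeddoor-2 g5, cell decomp-ns), `--supports stmt-NavierStokesRegularity-1222 --as helper`; theorems only.
`…WallOfSphereMeanEngine` proved WALL ⟸ ENGINE (`ShellMean.stubScalarLiouville_of_sphereMeanEngine`), ENGINE being: for every `(v, x₀, T)`
with the binders of `StubScalarLiouville`, the spherical-mean deviation `T(t,y) − T̄(t,‖y − x₀‖)` extends to a member of the elementary solution
class of KNSS's Lemma 2.1 (`KNSS2009_lemma21_halfball`).  Here the (easy) converse: under the wall `∇T(t) × (x − x₀) ≡ 0`, so `T(t,·)` is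
constant on every sphere about `x₀` (great-circle FTC), the deviation vanishes off the centre, and `f ≡ 0`, `a ≡ 0` is a member of the class.

* `inner_eq_zero_of_cross_eq_zero` — `a × y = 0`, `⟪w, y⟫ = 0`, `y ≠ 0` ⇒ `⟪a, w⟫ = 0` (Lagrange's identity on the tangential part of `a`).
* ★ `sphere_const_of_cross_gradient_eq_zero_off_centre` — `T` differentiable off `x₀` with radial gradient ⇒ `T(x₀ + rn) = T(x₀ + rn')` for
  all unit `n, n'`, `r ≠ 0`; `sphereIntegral_eq_of_sphere_const` — then `∫_{S²} T(x₀ + r·) dσ = σ(S²) T(x₀ + rn)`.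
* ★★ `sphereMeanEngine_of_stubScalarLiouville` (WALL ⟹ ENGINE) and ★★ `stubScalarLiouville_iff_sphereMeanEngine` (EXACT equivalence by name).

HONEST LABEL: bookkeeping that certifies ENGINE ⟺ WALL in the kernel (an ANALYTIC re-typing of KNSS's p. 10 architecture; no load moved; the
engine is the open content of the wall).  Nothing here proves `stub_scalarLiouville`, `PoloidalLiouville` (1222) or bears on Navier–Stokes
regularity; no summit statement is proved. [folklore] [cite: KochNadirashviliSereginSverak2009, Lemma 2.1 and proof of Thm 5.2 (arXiv:0709.3599 pp. 5, 10)]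
-/

noncomputable section

-- the summit and its single sub-problem share the name (CONVENTIONS §1)
set_option linter.dupNamespace false

open scoped Topology InnerProductSpace RealInnerProductSpace ContDiff Laplacian
open Filter Set Function Metric MeasureTheory intervalIntegral
open Literature.Analysis.FluidPDE

namespace Summit.NavierStokesRegularity.NavierStokesRegularity.Theorems.PoloidalLiouville.Antidynamo

namespace ShellMean

/-! ### §15 Radial gradients do no work along spheres -/

/-- If `a × y = 0` and `w ⊥ y` (`y ≠ 0`) then `⟪a, w⟫ = 0`: the tangential part `a − (⟪a,y⟫/‖y‖²) y` has `‖· × y‖ = ‖·‖‖y‖` (Lagrange), hence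
vanishes. [folklore] -/
theorem inner_eq_zero_of_cross_eq_zero {a y w : EuclideanSpace ℝ (Fin 3)} (hy : y ≠ 0) (hc : cross a y = 0) (hw : ⟪w, y⟫ = 0) :
    ⟪a, w⟫ = 0 := by
  have hy2 : ‖y‖ ^ 2 ≠ 0 := pow_ne_zero _ (norm_ne_zero_iff.mpr hy)
  set b : EuclideanSpace ℝ (Fin 3) := a - (⟪a, y⟫ / ‖y‖ ^ 2) • y with hb
  have hby : ⟪b, y⟫ = 0 := by
    rw [hb, inner_sub_left, inner_smul_left, real_inner_self_eq_norm_sq]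
    simp only [conj_trivial]
    field_simp
    ring
  have hbc : cross b y = 0 := by
    rw [hb]
    have : cross (a - (⟪a, y⟫ / ‖y‖ ^ 2) • y) y = cross a y - cross ((⟪a, y⟫ / ‖y‖ ^ 2) • y) y := by
      ext i
      fin_cases i <;> simp [cross, crossProduct, mul_sub]
    rw [this, hc, cross_smul_self_left, sub_zero]
  -- Lagrange: `‖b × y‖² = ‖b‖²‖y‖² − ⟪b,y⟫²`, so `b = 0`
  have hlag := CapSym.inner_cross_cross b y b y
  rw [hbc, inner_zero_left, real_inner_self_eq_norm_sq, real_inner_self_eq_norm_sq, hby] at hlag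
  simp only [zero_mul, sub_zero] at hlag
  have hb0 : ‖b‖ ^ 2 = 0 := by
    have : ‖b‖ ^ 2 * ‖y‖ ^ 2 = 0 := by linarith
    rcases mul_eq_zero.mp this with h | h
    · exact h
    · exact absurd h hy2
  have hbz : b = 0 := by
    rw [← norm_eq_zero]; exact pow_eq_zero_iff (two_ne_zero) |>.mp hb0
  -- `a = (⟪a,y⟫/‖y‖²) y`, orthogonal to `w`
  have ha : a = (⟪a, y⟫ / ‖y‖ ^ 2) • y := by
    rw [← sub_eq_zero]; exact hbz
  rw [real_inner_comm] at hw
  rw [ha, inner_smul_left, hw, mul_zero]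

/-- ★ **Radial gradient ⇒ constant on spheres.**  If `T` is differentiable off `x₀` and `∇T(y) × (y − x₀) = 0` for `y ≠ x₀`, then for all
unit `n, n'` and `r ≠ 0`, `T(x₀ + rn) = T(x₀ + rn')` (FTC along a great-circle arc, whose velocity is tangent). [folklore] -/
theorem sphere_const_of_cross_gradient_eq_zero_off_centre {T : EuclideanSpace ℝ (Fin 3) → ℝ} {x₀ : EuclideanSpace ℝ (Fin 3)}
    (hT : ∀ y, y ≠ x₀ → DifferentiableAt ℝ T y) (hrad : ∀ y, y ≠ x₀ → cross (gradient T y) (y - x₀) = 0)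
    {n n' : EuclideanSpace ℝ (Fin 3)} (hn : ‖n‖ = 1) (hn' : ‖n'‖ = 1) {r : ℝ} (hr : r ≠ 0) :
    T (x₀ + r • n) = T (x₀ + r • n') := by
  obtain ⟨e, θ, he, hne, -, -, hrep⟩ := exists_greatCircle_through hn hn'
  obtain ⟨hγd, hγc, hγ1, -, hγ0⟩ := greatCircle hn he hne
  set γ : ℝ → EuclideanSpace ℝ (Fin 3) := fun s => Real.cos s • n + Real.sin s • e with hγ
  -- the derivative of `s ↦ T (x₀ + r γ s)` vanishes
  have hderiv : ∀ s, HasDerivAt (fun τ : ℝ => T (x₀ + r • γ τ)) 0 s := by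
    intro s
    have hne0 : x₀ + r • γ s ≠ x₀ := centre_add_smul_ne (hγ1 s) hr
    have hin : HasDerivAt (fun τ : ℝ => x₀ + r • γ τ) (r • deriv γ s) s :=
      ((hγd s).hasDerivAt.const_smul r).const_add x₀
    have hφ' : HasFDerivAt T ((InnerProductSpace.toDual ℝ (EuclideanSpace ℝ (Fin 3))) (gradient T (x₀ + r • γ s)))
        (x₀ + r • γ s) := (hT _ hne0).hasGradientAt.hasFDerivAt
    have h := hφ'.comp_hasDerivAt s hin
    refine h.congr_deriv ?_
    rw [InnerProductSpace.toDual_apply_apply, inner_smul_right]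
    have hperp : ⟪deriv γ s, x₀ + r • γ s - x₀⟫ = 0 := by
      rw [add_sub_cancel_left, inner_smul_right, real_inner_comm, inner_self_deriv_eq_zero_of_norm_eq_one hγd hγ1 s, mul_zero]
    have hγs0 : γ s ≠ 0 := by
      intro h0
      have h1 : ‖γ s‖ = 1 := hγ1 s
      rw [h0, norm_zero] at h1
      exact zero_ne_one h1
    have hy0 : x₀ + r • γ s - x₀ ≠ 0 := by
      rw [add_sub_cancel_left]; exact smul_ne_zero hr hγs0
    rw [inner_eq_zero_of_cross_eq_zero hy0 (hrad _ hne0) hperp, mul_zero]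
  -- so it is constant
  have hconst := is_const_of_deriv_eq_zero (f := fun τ : ℝ => T (x₀ + r • γ τ))
    (fun s => (hderiv s).differentiableAt) (fun s => (hderiv s).deriv) 0 θ
  have h0 : γ 0 = n := hγ0
  have hθ : γ θ = n' := hrep.symm
  simp only [h0, hθ] at hconst
  exact hconst

/-- The sphere integral of a function that is constant on the sphere of radius `r` about `x₀`: `∫_{S²} T(x₀ + r·) dσ = σ(S²)·T(x₀ + rn)`.
[folklore] -/
theorem sphereIntegral_eq_of_sphere_const {T : EuclideanSpace ℝ (Fin 3) → ℝ} {x₀ n : EuclideanSpace ℝ (Fin 3)} {r : ℝ}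
    (hconst : ∀ α : sphere (0 : EuclideanSpace ℝ (Fin 3)) 1, T (x₀ + r • (α : EuclideanSpace ℝ (Fin 3))) = T (x₀ + r • n)) :
    sphereIntegral volume (fun z => T (x₀ + z)) r =
      ((volume : Measure (EuclideanSpace ℝ (Fin 3))).toSphere).real univ * T (x₀ + r • n) := by
  rw [sphereIntegral_translate, integral_congr_ae (Eventually.of_forall hconst), MeasureTheory.integral_const, smul_eq_mul]

/-! ### §16 WALL ⟹ ENGINE, and the exact equivalence -/

/-- ★★ **WALL ⟹ ENGINE.**  Under `StubScalarLiouville`, for every `(v, x₀, T)` with its binders the spherical-mean deviation of `T`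
vanishes off the centre, so `f ≡ 0` (drift `a ≡ 0`) is the required member of Lemma 2.1's class. [folklore] -/
theorem sphereMeanEngine_of_stubScalarLiouville (hW : StubScalarLiouville) :
    ∀ (v : ℝ → EuclideanSpace ℝ (Fin 3) → EuclideanSpace ℝ (Fin 3)) (x₀ : EuclideanSpace ℝ (Fin 3))
      (T : ℝ → EuclideanSpace ℝ (Fin 3) → ℝ),
      Literature.Analysis.FluidPDE.IsBoundedAncientMildSolution 1 v →
      (∀ t < 0, AEStronglyMeasurable (v t) volume) →
      ContDiffOn ℝ (⊤ : ℕ∞) (Function.uncurry v) (Set.Iio 0 ×ˢ Set.univ) →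
      ContDiffOn ℝ (⊤ : ℕ∞) (Function.uncurry T) (Set.Iio 0 ×ˢ ({x₀}ᶜ : Set (EuclideanSpace ℝ (Fin 3)))) →
      (∃ C : ℝ, ∀ t < 0, ∀ x, |T t x| ≤ C) →
      (∀ t < 0, ∀ x, curl (v t) x = cross (gradient (T t) x) (x - x₀)) →
      (∀ t < 0, ∀ x, x ≠ x₀ →
        cross (gradient (fun z => deriv (fun s => T s z) t + inner ℝ (v t z) (gradient (T t) z)
              - Laplacian.laplacian (T t) z) x) (x - x₀) =
          cross (gradient (fun z => inner ℝ (v t z) (z - x₀)) x) (gradient (T t) x)) →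
      ∃ (f : ℝ → EuclideanSpace ℝ (Fin 3) → ℝ) (a : ℝ → EuclideanSpace ℝ (Fin 3) → EuclideanSpace ℝ (Fin 3)) (A : ℝ),
        (∀ t < 0, ∀ y, y ≠ x₀ → f t y = T t y -
          sphereIntegral volume (fun z => T t (x₀ + z)) ‖y - x₀‖ /
            ((volume : Measure (EuclideanSpace ℝ (Fin 3))).toSphere).real univ) ∧
        Measurable (uncurry a) ∧ (∀ t < 0, ∀ y, ‖a t y‖ ≤ A) ∧
        (∃ C : ℝ, ∀ t < 0, ∀ y, |f t y| ≤ C) ∧ (∀ t < 0, ContDiff ℝ 2 (f t)) ∧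
        (∃ C : ℝ, ∀ t < 0, ∀ y, ‖fderiv ℝ (f t) y‖ ≤ C ∧ |(Δ (f t)) y| ≤ C) ∧
        ContinuousOn (fun p : ℝ × EuclideanSpace ℝ (Fin 3) => fderiv ℝ (f p.1) p.2) (Iio 0 ×ˢ univ) ∧
        ContinuousOn (fun p : ℝ × EuclideanSpace ℝ (Fin 3) => (Δ (f p.1)) p.2) (Iio 0 ×ˢ univ) ∧
        (∀ y, ∀ s t : ℝ, s ≤ t → t < 0 →
          f t y - f s y = ∫ τ in s..t, ((Δ (f τ)) y - fderiv ℝ (f τ) y (a τ y))) := by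
  intro v x₀ T hB hm hsm hsT hTb hrep hE1
  have hwall := hW v x₀ T hB hm hsm hsT hTb hrep hE1
  have hσpos : 0 < ((volume : Measure (EuclideanSpace ℝ (Fin 3))).toSphere).real univ := toSphere_real_univ_pos
  have hO : IsOpen (({x₀}ᶜ : Set (EuclideanSpace ℝ (Fin 3)))) := isOpen_compl_singleton
  -- the deviation vanishes off the centre
  have hdev : ∀ t < 0, ∀ y, y ≠ x₀ → T t y -
      sphereIntegral volume (fun z => T t (x₀ + z)) ‖y - x₀‖ /
        ((volume : Measure (EuclideanSpace ℝ (Fin 3))).toSphere).real univ = 0 := by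
    intro t ht y hy
    have hι : ContDiff ℝ (⊤ : ℕ∞) fun z : EuclideanSpace ℝ (Fin 3) => (t, z) := contDiff_prodMk_right t
    have hTt : ContDiffOn ℝ (⊤ : ℕ∞) (T t) ({x₀}ᶜ) := hsT.comp hι.contDiffOn fun z hz => ⟨ht, hz⟩
    have hTd : ∀ z, z ≠ x₀ → DifferentiableAt ℝ (T t) z := fun z hz =>
      (hTt.contDiffAt (hO.mem_nhds hz)).differentiableAt (by simp)
    have hr : ‖y - x₀‖ ≠ 0 := norm_ne_zero_iff.mpr (sub_ne_zero.mpr hy)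
    set n : EuclideanSpace ℝ (Fin 3) := ‖y - x₀‖⁻¹ • (y - x₀) with hn
    have hn1 : ‖n‖ = 1 := by rw [hn, norm_smul, norm_inv, norm_norm, inv_mul_cancel₀ hr]
    have hyn : y = x₀ + ‖y - x₀‖ • n := by
      rw [hn, smul_smul, mul_inv_cancel₀ hr, one_smul]; abel
    have hconst : ∀ α : sphere (0 : EuclideanSpace ℝ (Fin 3)) 1,
        T t (x₀ + ‖y - x₀‖ • (α : EuclideanSpace ℝ (Fin 3))) = T t (x₀ + ‖y - x₀‖ • n) := fun α =>
      sphere_const_of_cross_gradient_eq_zero_off_centre hTd (fun z hz => hwall t ht z) (norm_eq_of_mem_sphere α) hn1 hr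
    rw [sphereIntegral_eq_of_sphere_const hconst, mul_div_cancel_left₀ _ hσpos.ne', ← hyn, sub_self]
  refine ⟨fun _ _ => 0, fun _ _ => 0, 0, fun t ht y hy => (hdev t ht y hy).symm, measurable_const, fun t _ y => by simp,
    ⟨0, fun t _ y => by simp⟩, fun t _ => contDiff_const, ⟨0, fun t _ y => ?_⟩, ?_, ?_, fun y s t _ _ => ?_⟩
  · simp
  · simpa using continuousOn_const
  · simpa using continuousOn_const
  · simp

/-- ★★ **WALL ⟺ ENGINE (spherical-mean gauge)**, kernel-certified: `StubScalarLiouville` holds iff, for every `(v, x₀, T)` with its binders, the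
spherical-mean deviation of `T` extends to a member of the elementary solution class of KNSS's Lemma 2.1. [folklore] -/
theorem stubScalarLiouville_iff_sphereMeanEngine :
    StubScalarLiouville ↔
    ∀ (v : ℝ → EuclideanSpace ℝ (Fin 3) → EuclideanSpace ℝ (Fin 3)) (x₀ : EuclideanSpace ℝ (Fin 3))
      (T : ℝ → EuclideanSpace ℝ (Fin 3) → ℝ),
      Literature.Analysis.FluidPDE.IsBoundedAncientMildSolution 1 v →
      (∀ t < 0, AEStronglyMeasurable (v t) volume) →
      ContDiffOn ℝ (⊤ : ℕ∞) (Function.uncurry v) (Set.Iio 0 ×ˢ Set.univ) →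
      ContDiffOn ℝ (⊤ : ℕ∞) (Function.uncurry T) (Set.Iio 0 ×ˢ ({x₀}ᶜ : Set (EuclideanSpace ℝ (Fin 3)))) →
      (∃ C : ℝ, ∀ t < 0, ∀ x, |T t x| ≤ C) →
      (∀ t < 0, ∀ x, curl (v t) x = cross (gradient (T t) x) (x - x₀)) →
      (∀ t < 0, ∀ x, x ≠ x₀ →
        cross (gradient (fun z => deriv (fun s => T s z) t + inner ℝ (v t z) (gradient (T t) z)
              - Laplacian.laplacian (T t) z) x) (x - x₀) =
          cross (gradient (fun z => inner ℝ (v t z) (z - x₀)) x) (gradient (T t) x)) →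
      ∃ (f : ℝ → EuclideanSpace ℝ (Fin 3) → ℝ) (a : ℝ → EuclideanSpace ℝ (Fin 3) → EuclideanSpace ℝ (Fin 3)) (A : ℝ),
        (∀ t < 0, ∀ y, y ≠ x₀ → f t y = T t y -
          sphereIntegral volume (fun z => T t (x₀ + z)) ‖y - x₀‖ /
            ((volume : Measure (EuclideanSpace ℝ (Fin 3))).toSphere).real univ) ∧
        Measurable (uncurry a) ∧ (∀ t < 0, ∀ y, ‖a t y‖ ≤ A) ∧
        (∃ C : ℝ, ∀ t < 0, ∀ y, |f t y| ≤ C) ∧ (∀ t < 0, ContDiff ℝ 2 (f t)) ∧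
        (∃ C : ℝ, ∀ t < 0, ∀ y, ‖fderiv ℝ (f t) y‖ ≤ C ∧ |(Δ (f t)) y| ≤ C) ∧
        ContinuousOn (fun p : ℝ × EuclideanSpace ℝ (Fin 3) => fderiv ℝ (f p.1) p.2) (Iio 0 ×ˢ univ) ∧
        ContinuousOn (fun p : ℝ × EuclideanSpace ℝ (Fin 3) => (Δ (f p.1)) p.2) (Iio 0 ×ˢ univ) ∧
        (∀ y, ∀ s t : ℝ, s ≤ t → t < 0 →
          f t y - f s y = ∫ τ in s..t, ((Δ (f τ)) y - fderiv ℝ (f τ) y (a τ y))) :=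
  ⟨sphereMeanEngine_of_stubScalarLiouville, stubScalarLiouville_of_sphereMeanEngine⟩

end ShellMean

end Summit.NavierStokesRegularity.NavierStokesRegularity.Theorems.PoloidalLiouville.Antidynamo
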